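import Summits.QuantumFields.BalabanUV.Beta.FP.RelInvPeriodisedCombRecord
import Summits.QuantumFields.BalabanUV.Beta.FP.NestedStepLawTorusInstance

/-!
# `BalabanUV.Beta.FP.RelInvPeriodisedCombTorusLetters` — road «FP» (binder row D1), ROUTE T, the (J-a) dictionary's item **(γ-sym)** AT THE TORUS CALL's INDEX TYPES:
# **`h1`, `hId`, `h2` OF THE GRADED DOOR FOR THE CHART-(III′) TABLES, AS TERMS** — the chart-(III′) twins of the OWNER's `NestedStepLawTorusInstance.torus_h1` and of
# leaf-05's `RelInvPeriodisedEffFormCoarse.hId_order_zero_record ∕ torus_h2_record` at gan24-leaf-05's coarse-site presentation `(p̄, κ) ↦ (coarsePt M′ Lc p̄, inr κ)`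
# (`coarseSlot_injective ∕ coarseSlot_range`), roots `ρ_c = ctr (d+1) Lc` on both boxes — what leaf-02's (β) `…RowsGradedLevelZeroSym` feeds into the displayed sockets

HONEST DEPENDENCY (page 1, mandatory): continuum YM on T⁴ ⇐ BetaPertH ∧ nine spine estimates (0/9 proved); BetaPertH ⇐ (D1) ∧ (D4) ∧
CAP+tail; G-an2-4 gates asym, D1 and NE2/3/4.  HONEST FRAMING (cell contract, verbatim): «discharging `BetaPertH` makes Bałaban's UV
stability UNCONDITIONAL — a real constructive-QFT result; it is NOT the continuum limit and NOT the Clay problem.»  ABSOLUTE RULE (cell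
charter, verbatim): «No internally-minted statement may enter as a cited fact. Every hypothesis is either kernel-proved in this package or a
verbatim quotation of a PUBLISHED theorem with page reference. The manuscript(s) under audit are NOT citable for their own disputed steps — they
are the thing under adjudication; programme-internal (2001/route/tribunal) claims are never citable.»

CONTENT: §0 `bhKStepSh_ff_symm`, **`torus_H₀_transpose_comb`** (`H₀′ᵀ = H₀′` on any torus with `Lc ∣ T i`, every level — the (β-a) door's `hH₀t` socket);
§1 (one-line instances of `RelInvPeriodisedCombRecord`): `torus_h1_comb` (`det kkt H₀′ [Q₁₀′; τ₁] ≠ 0`, `H₀′ Q₁₀′` read off `perF (fine Lc M′) (bhKStepSh d Lc (Dsh Lc) j)`,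
`τ₁ := combRowsT (ctr (d+1) Lc) Lc (fine Lc M′)` on the field slots), `hId_comb` (`(effForm H₀′ [Q₁₀′; τ₁]).toBlocks₁₁ = (wVH d Lc (j+1))⁻¹ • H′(M′, j+1)`), `torus_h2_comb_record`
(`det kkt ((effForm H₀′ [Q₁₀′;τ₁]).toBlocks₁₁) [Q₂₀′; τ₂] ≠ 0`, the coarse rows `Q₂₀′` read off `perF M′ (bhKStepSh d Lc (Dsh Lc) (j+1))` on any coarse-coarse presentation `(pμ′, inr ∘ mμ′)`
with `hfμ′ hcoarse′`, `τ₂ := combRowsT (ctr (d+1) Lc) Lc M′`).  `hPW` is chart-free (the OWNER's `torus_uniP` at `r = r′ = ctrOff (d+1) Lc`); the covariance rows `c0` at the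
(0.4) border are (α)∕(COV) rows (leaf-02 ∕ an1), NOT here.  [folklore]; no `Prop`, no `def`, nothing cited, 0 sorry; discharges NO binder of row D1; NOT (J-a) (which slot
of the door these objects fill is the dictionary's word), NOT (T-ID), NOT SDF, NOT D1, NOT BetaPertH, NOT continuum, NOT Clay; 0 estimates.
Unit `b2b-balaban-beta-d1-formalise-leaf-05` (gen 29), 2026-08-22; no existing file touched.
-/

noncomputable section

open scoped BigOperators Matrix

namespace Summit.QuantumFields.BalabanUV.Beta.FP.RelInvPeriodisedCombTorusLetters

open Matrix
open Literature.Probability.LatticeModels (Torus.proj)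
open Literature.MathematicalPhysics.QuantumFieldTheory.Balaban1983to89
open Literature.MathematicalPhysics.QuantumFieldTheory.Balaban1983to89.Beta
open Literature.MathematicalPhysics.QuantumFieldTheory.Balaban1983to89.Beta.Composition (kkt)
open Literature.MathematicalPhysics.QuantumFieldTheory.Balaban1983to89.Beta.CompositionSingular (effForm)
open B5Prop11Plancherel (fine)
open B6Lemma24Torus (pbox)
open AffineAveraging (Site box toSite)
open AveragingContoursRooted (ctr ctrOff)
open OneStepResolventKernel (Fib)
open BalabanStepJetsSucc (wVH)
open Summit.QuantumFields.BalabanUV.Beta.SymShiftedSpread (bhKStepSh)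
open Summit.QuantumFields.BalabanUV.Beta.DshAn1 (Dsh)
open B4TorusKernel.MultiPeriod (translate)
open ExpKernelCalculus (shiftK)
open Summit.QuantumFields.BalabanUV.Beta.TameKernelCalculus (trK trK_apply)
open Summit.QuantumFields.BalabanUV.Beta.BorderedHessian (sgnK sgnK_apply sgnF_inl)
open Summit.QuantumFields.BalabanUV.Beta.FP.KernelPeriodisationFib (Idx perF perF_apply perZ_apply trF perF_transpose translate_invariant_of_shiftK)
open Summit.QuantumFields.BalabanUV.Beta.FP.RelInvPeriodisedComb (trK_bhKStepSh shiftK_bhKStepSh)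
open Summit.QuantumFields.BalabanUV.Beta.FP.TorusGaugeCovarianceCoarse (coarsePt coarsePt_coe)
open Summit.QuantumFields.BalabanUV.Beta.FP.TorusCombRows (Res combRowsT)
open Summit.QuantumFields.BalabanUV.Beta.FP.NestedStepLawTorusInstance (dvd_fine coarseSlot_injective coarseSlot_range)
open Summit.QuantumFields.BalabanUV.Beta.FP.RelInvPeriodisedCombRecord (torus_isUnit_det_kkt_combRows_comb hId_order_zero_record_comb torus_h2_record_comb)

variable {d : ℕ} (M' : Fin (d + 1) → ℕ) [∀ μ, NeZero (M' μ)] {Lc : ℕ} [NeZero Lc]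

/-! ## §0 The chart-(III′) form block is symmetric: the `hH₀t` socket -/

omit [∀ μ, NeZero (M' μ)] in
/-- [folklore] **THE FIELD BLOCK OF `𝕄′_j` IS SYMMETRIC** (entrywise, every level): the `(inl, inl)` entry of `trK 𝕄′_j = sgnK 𝕄′_j` (`RelInvPeriodisedComb.trK_bhKStepSh`). -/
theorem bhKStepSh_ff_symm (j : ℕ) (x y : Site (d + 1)) (κ l : Fin (d + 1)) :
    bhKStepSh d Lc (Dsh Lc) j x y (Sum.inl κ) (Sum.inl l) = bhKStepSh d Lc (Dsh Lc) j y x (Sum.inl l) (Sum.inl κ) := by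
  have h := congrFun (congrFun (congrFun (congrFun (trK_bhKStepSh (d := d) (Lc := Lc) j) y) x) (Sum.inl l)) (Sum.inl κ)
  rw [trK_apply, sgnK_apply, sgnF_inl, sgnF_inl, one_mul, one_mul] at h
  exact h

/-- **[folklore] `H₀′ᵀ = H₀′` ON ANY TORUS WITH `Lc ∣ T i`, EVERY LEVEL** — the `hH₀t` socket of leaf-02's (β-a) `…TransportedGradedSym` for `H₀′ :=` the field block of
`perF T (bhKStepSh d Lc (Dsh Lc) j)` (leaf-02's `PeriodisedWardOrderZero.torus_H₀_transpose` argument with the chart-(III′) letters: `Tℤ^{d+1}`-invariance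
`RelInvPeriodisedComb.shiftK_bhKStepSh` ⇒ `(perF K)ᵀ = perF (trF K)` (`perF_transpose`), and the field block of `trF K` is that of `K` by `bhKStepSh_ff_symm`). -/
theorem torus_H₀_transpose_comb (T : Fin (d + 1) → ℕ) [∀ μ, NeZero (T μ)] (hT : ∀ i, Lc ∣ T i) (j : ℕ) :
    ((perF T (bhKStepSh d Lc (Dsh Lc) j)).submatrix (fun b : ↥(pbox T) × Fin (d + 1) => ((b.1, Sum.inl b.2) : Idx T (Fib d)))
        (fun b : ↥(pbox T) × Fin (d + 1) => ((b.1, Sum.inl b.2) : Idx T (Fib d))))ᵀ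
      = (perF T (bhKStepSh d Lc (Dsh Lc) j)).submatrix (fun b : ↥(pbox T) × Fin (d + 1) => ((b.1, Sum.inl b.2) : Idx T (Fib d)))
          (fun b : ↥(pbox T) × Fin (d + 1) => ((b.1, Sum.inl b.2) : Idx T (Fib d))) := by
  rw [Matrix.transpose_submatrix, ← perF_transpose T (translate_invariant_of_shiftK T (fun t => shiftK_bhKStepSh (d := d) (Lc := Lc) t j) hT)]
  ext p q
  simp only [Matrix.submatrix_apply, perF_apply, perZ_apply, trF]
  exact tsum_congr fun m => (bhKStepSh_ff_symm j _ _ _ _).symm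

/-! ## §1 `h1`, `hId`, `h2` at the torus call's index types -/

set_option synthInstance.maxSize 1024 in
/-- **[folklore] `h1` AT THE TORUS FOR THE CHART-(III′) TABLES** (twin of the OWNER's `NestedStepLawTorusInstance.torus_h1`): the comb-sliced fine system of chart (III′)
on `fine Lc M′`, level `j`, coarse multipliers at gan24-leaf-05's coarse-site presentation, comb rows at the root `ρ_c`, is non-degenerate. -/
theorem torus_h1_comb (j : ℕ) :
    (kkt ((perF (fine Lc M') (bhKStepSh d Lc (Dsh Lc) j)).submatrix
            (fun b : ↥(pbox (fine Lc M')) × Fin (d + 1) => ((b.1, Sum.inl b.2) : Idx (fine Lc M') (Fib d)))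
            (fun b : ↥(pbox (fine Lc M')) × Fin (d + 1) => ((b.1, Sum.inl b.2) : Idx (fine Lc M') (Fib d))))
      (fromRows
        ((perF (fine Lc M') (bhKStepSh d Lc (Dsh Lc) j)).submatrix
            (fun a : ↥(pbox M') × Fin (d + 1) => ((coarsePt M' Lc a.1, Sum.inr a.2) : Idx (fine Lc M') (Fib d)))
            (fun b : ↥(pbox (fine Lc M')) × Fin (d + 1) => ((b.1, Sum.inl b.2) : Idx (fine Lc M') (Fib d))))
        ((combRowsT (ctr (d + 1) Lc) Lc (fine Lc M')).submatrix id
            (fun b : ↥(pbox (fine Lc M')) × Fin (d + 1) => ((b.1, Sum.inl b.2) : Idx (fine Lc M') (Fib d)))))).det ≠ 0 :=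
  (torus_isUnit_det_kkt_combRows_comb (fine Lc M') (dvd_fine M') j _ (coarseSlot_injective M') (fun a => ⟨a.2, rfl⟩)
    (coarseSlot_range M')).ne_zero

set_option synthInstance.maxSize 1024 in
/-- **[folklore] `hId` AT THE TORUS FOR THE CHART-(III′) TABLES**: `(effForm H₀′ [Q₁₀′; τ₁]).toBlocks₁₁ = (wVH d Lc (j+1))⁻¹ • H′(M′, j+1)` — the effective corner of the
chart-(III′) comb-sliced fine system is the next level's chart-(III′) field block up to the displayed unit (twin of `hId_order_zero_record` at `cp := coarsePt M′ Lc`). -/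
theorem hId_comb (j : ℕ) :
    (effForm ((perF (fine Lc M') (bhKStepSh d Lc (Dsh Lc) j)).submatrix
          (fun b : ↥(pbox (fine Lc M')) × Fin (d + 1) => ((b.1, Sum.inl b.2) : Idx (fine Lc M') (Fib d)))
          (fun b : ↥(pbox (fine Lc M')) × Fin (d + 1) => ((b.1, Sum.inl b.2) : Idx (fine Lc M') (Fib d))))
        (fromRows
          ((perF (fine Lc M') (bhKStepSh d Lc (Dsh Lc) j)).submatrix
            (fun a : ↥(pbox M') × Fin (d + 1) => ((coarsePt M' Lc a.1, Sum.inr a.2) : Idx (fine Lc M') (Fib d)))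
            (fun b : ↥(pbox (fine Lc M')) × Fin (d + 1) => ((b.1, Sum.inl b.2) : Idx (fine Lc M') (Fib d))))
          ((combRowsT (ctr (d + 1) Lc) Lc (fine Lc M')).submatrix id
            (fun b : ↥(pbox (fine Lc M')) × Fin (d + 1) => ((b.1, Sum.inl b.2) : Idx (fine Lc M') (Fib d)))))).toBlocks₁₁
      = (wVH d Lc (j + 1))⁻¹ • (perF M' (bhKStepSh d Lc (Dsh Lc) (j + 1))).submatrix
          (fun b : ↥(pbox M') × Fin (d + 1) => ((b.1, Sum.inl b.2) : Idx M' (Fib d))) (fun b : ↥(pbox M') × Fin (d + 1) => ((b.1, Sum.inl b.2) : Idx M' (Fib d))) :=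
  hId_order_zero_record_comb M' j (coarsePt M' Lc) (coarsePt_coe M' Lc) (coarseSlot_injective M') (coarseSlot_range M')

set_option synthInstance.maxSize 1024 in
/-- **[folklore] `h2` AT THE TORUS FOR THE CHART-(III′) TABLES** (twin of `torus_h2_record` at `cp := coarsePt M′ Lc`; `Lc ∣ M′_i`; the coarse one-step rows of chart (III′) at
level `j + 1` on any coarse-coarse presentation `(pμ′, inr ∘ mμ′)` with `hfμ′ hcoarse′`; `τ₂ := combRowsT (ctr (d+1) Lc) Lc M′` on the field slots):
`det kkt ((effForm H₀′ [Q₁₀′; τ₁]).toBlocks₁₁) [Q₂₀′; τ₂] ≠ 0` — with `G₀ = 0` this is the door's displayed `h2`. -/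
theorem torus_h2_comb_record (j : ℕ) (hM' : ∀ i, Lc ∣ M' i)
    {κ : Type*} [Fintype κ] [DecidableEq κ] (pμ' : κ → ↥(pbox M')) (mμ' : κ → Fin (d + 1))
    (hfμ' : Function.Injective (fun a : κ => ((pμ' a, Sum.inr (mμ' a)) : Idx M' (Fib d))))
    (hcoarse' : ∀ (s : ↥(pbox M')) (m : Fin (d + 1)),
      ((s, Sum.inr m) : Idx M' (Fib d)) ∈ Set.range (fun a : κ => ((pμ' a, Sum.inr (mμ' a)) : Idx M' (Fib d))) ↔ Torus.proj Lc (s : Site (d + 1)) = 0) :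
    (kkt
      (effForm ((perF (fine Lc M') (bhKStepSh d Lc (Dsh Lc) j)).submatrix
            (fun b : ↥(pbox (fine Lc M')) × Fin (d + 1) => ((b.1, Sum.inl b.2) : Idx (fine Lc M') (Fib d)))
            (fun b : ↥(pbox (fine Lc M')) × Fin (d + 1) => ((b.1, Sum.inl b.2) : Idx (fine Lc M') (Fib d))))
          (fromRows
            ((perF (fine Lc M') (bhKStepSh d Lc (Dsh Lc) j)).submatrix
              (fun a : ↥(pbox M') × Fin (d + 1) => ((coarsePt M' Lc a.1, Sum.inr a.2) : Idx (fine Lc M') (Fib d)))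
              (fun b : ↥(pbox (fine Lc M')) × Fin (d + 1) => ((b.1, Sum.inl b.2) : Idx (fine Lc M') (Fib d))))
            ((combRowsT (ctr (d + 1) Lc) Lc (fine Lc M')).submatrix id
              (fun b : ↥(pbox (fine Lc M')) × Fin (d + 1) => ((b.1, Sum.inl b.2) : Idx (fine Lc M') (Fib d)))))).toBlocks₁₁
      (fromRows
        ((perF M' (bhKStepSh d Lc (Dsh Lc) (j + 1))).submatrix (fun a : κ => ((pμ' a, Sum.inr (mμ' a)) : Idx M' (Fib d)))
          (fun b : ↥(pbox M') × Fin (d + 1) => ((b.1, Sum.inl b.2) : Idx M' (Fib d))))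
        ((combRowsT (ctr (d + 1) Lc) Lc M').submatrix id (fun b : ↥(pbox M') × Fin (d + 1) => ((b.1, Sum.inl b.2) : Idx M' (Fib d)))))).det ≠ 0 :=
  torus_h2_record_comb M' j hM' (coarsePt M' Lc) (coarsePt_coe M' Lc) (coarseSlot_injective M') (coarseSlot_range M')
    (fun a : κ => ((pμ' a, Sum.inr (mμ' a)) : Idx M' (Fib d))) hfμ' (fun a => ⟨mμ' a, rfl⟩) hcoarse'

end Summit.QuantumFields.BalabanUV.Beta.FP.RelInvPeriodisedCombTorusLetters

end
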